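import Summits.Ventures.YMGap.Thresholds.ConnectedFourPointCrude
import Summits.Ventures.YMGap.Thresholds.ConnectedThreePointDecayDim
import HarnessLib

/-!
# Venture YMGap — C-SUS4 every `d`, every `N`: CRUDE cross-covariance bounds for products of Lipschitz cylinders under the
# `SU(N)` strong-coupling state on `ℤ^d` (Dobrushin door window), uniform data `(n, L, M)` — twin of `ConnectedFourPointCrude`

HONEST FRAMING: venture file of the cell `pub-ymgap` (QuantumFields programme), seat ds-1 (gen 10).  Strong-coupling LATTICE
statements for `SU(N)` lattice Yang–Mills on `ℤ^d` with the Wilson action inside the Dobrushin door window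
`doorPoly d (K b₁/N) < 1` under the one-link modulus hypotheses `OneLinkKRModulus N R K` (tree coupling `0 ≤ b ≤ b₁`);
cumulant estimates of the unique DLR state only; nothing about the continuum or the Clay problem.
For Lipschitz cylinders with supports of size `≤ n`, constants `≤ L`, sup bounds `≤ M`, separated by `m` across the split,
`E(m) = 4(2√N)² e^{−κ_d(m−2)}`: `cov_crude1_dim` (`|Cov(X,W)| ≤ E (nL)²`), `cov_crude2_dim`
(`|Cov(XY,W)| ≤ E (2n·2ML)(nL)`), `cov_crude2'_dim` (`|Cov(Y,ZW)|`), `cov_crude3_dim` (`|Cov(XYZ,W)| ≤ E (3n·3M²L)(nL)`),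
`cov_crude4_dim` (`|Cov(XY,ZW)| ≤ E (2n·2ML)²`); (the elementary `abs_sub4_le`, `abs_sub6_le`, `le_crude`, `abs_cov_le_two_mul` are in `ConnectedFourPointCrude`).
Consumed by `ConnectedFourPointBoundsDim`.

References (mechanism only): R. L. Dobrushin, S. B. Shlosman (1985/87); M. Duneau, D. Iagolnitzer, B. Souillard, CMP 31 (1973).
-/

noncomputable section

open MeasureTheory ProbabilityTheory Function Finset Filter Topology Real Set
open scoped NNReal
open Literature.MathematicalPhysics.QuantumLattice (LGConfig ZdEdge fundamentalRep ymGibbsMeasures)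
open Literature.MathematicalPhysics.QuantumFieldTheory hiding ZdEdge
open Literature.MathematicalPhysics.QuantumFieldTheory.Balaban1983to89.StrongCouplingDobrushinWindow (OneLinkKRModulus)
open Summit.Ventures.YMGap.StarResolventDim (gaugeR doorPoly)

namespace Summit.Ventures.YMGap.CouplingResponse

/-- Local shorthand: the any-`d` Dobrushin–Shlosman rate `κ_d(R_G^{(d)}(c)) = (1 − ρ)²/(2(2ρ·2d + 1))`, `ρ = R_G^{(d)}(c)`. -/
local notation3 (prettyPrint := false) "dimκ(" d' ", " c ")" =>
  (1 - gaugeR d' c) ^ 2 / (2 * (2 * gaugeR d' c * ((2 * d' : ℕ) : ℝ) + 1))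

/-! ### Crude cross-covariance bounds with uniform data `(n, L, M)` -/

section Crude

variable {d N : ℕ} {R K b₁ b : ℝ} {μ : Measure (LGConfig d (Matrix.specialUnitaryGroup (Fin N) ℂ))}

/-- Crude single–single bound: `|Cov(X, W)| ≤ E(m) (nL)(nL)`. -/
theorem cov_crude1_dim (hd : 2 ≤ d) (hN : 1 ≤ N) (hK0 : 0 ≤ K)
    (hmod : OneLinkKRModulus N R K) (hR : b₁ / N * (2 * ((d : ℝ) - 1)) ≤ R) (hdoor : doorPoly d (K * (b₁ / N)) < 1)
    (h0 : 0 ≤ b) (hb : b ≤ b₁) (hμ : μ ∈ ymGibbsMeasures (d := d) (fundamentalRep (Fin N)) b)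
    {X W : LGConfig d (Matrix.specialUnitaryGroup (Fin N) ℂ) → ℝ} {Λ₁ Λ₄ : Finset (ZdEdge d)} {K₁ K₄ : ℝ≥0}
    (hX : IsLipschitzCylinder (fundamentalRep (Fin N)) X Λ₁ K₁) (hW : IsLipschitzCylinder (fundamentalRep (Fin N)) W Λ₄ K₄)
    {n : ℕ} {L : ℝ≥0} (hn₁ : Λ₁.card ≤ n) (hn₄ : Λ₄.card ≤ n) (hL₁ : K₁ ≤ L) (hL₄ : K₄ ≤ L)
    {m : ℕ} (hsep : ∀ a ∈ Λ₁, ∀ b ∈ Λ₄, (m : ℝ) ≤ ‖a.1 - b.1‖) :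
    |cov[X, W; μ]| ≤ 4 * (2 * Real.sqrt N) ^ 2 * Real.exp (-(dimκ(d, K * (b₁ / N)) * ((m - 2 : ℕ) : ℝ))) *
      ((n : ℝ) * L) * ((n : ℝ) * L) := by
  have c := abs_cov_le_of_sep_dim hd hN hK0 hmod hR hdoor h0 hb hμ hX hW hsep
  have hn₁' : (Λ₁.card : ℝ) ≤ n := by exact_mod_cast hn₁
  have hn₄' : (Λ₄.card : ℝ) ≤ n := by exact_mod_cast hn₄
  have hL₁' : (K₁ : ℝ) ≤ L := by exact_mod_cast hL₁
  have hL₄' : (K₄ : ℝ) ≤ L := by exact_mod_cast hL₄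
  exact le_crude c (by positivity) (by positivity) (by positivity) (mul_le_mul hn₁' hL₁' K₁.2 (Nat.cast_nonneg _))
    (mul_le_mul hn₄' hL₄' K₄.2 (Nat.cast_nonneg _))

/-- Crude pair–single bound: `|Cov(XY, W)| ≤ E(m) (2n·2ML)(nL)`. -/
theorem cov_crude2_dim (hd : 2 ≤ d) (hN : 1 ≤ N) (hK0 : 0 ≤ K)
    (hmod : OneLinkKRModulus N R K) (hR : b₁ / N * (2 * ((d : ℝ) - 1)) ≤ R) (hdoor : doorPoly d (K * (b₁ / N)) < 1)
    (h0 : 0 ≤ b) (hb : b ≤ b₁) (hμ : μ ∈ ymGibbsMeasures (d := d) (fundamentalRep (Fin N)) b)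
    {X Y W : LGConfig d (Matrix.specialUnitaryGroup (Fin N) ℂ) → ℝ} {Λ₁ Λ₂ Λ₄ : Finset (ZdEdge d)} {K₁ K₂ K₄ M₁ M₂ : ℝ≥0}
    (hX : IsLipschitzCylinder (fundamentalRep (Fin N)) X Λ₁ K₁) (hY : IsLipschitzCylinder (fundamentalRep (Fin N)) Y Λ₂ K₂)
    (hW : IsLipschitzCylinder (fundamentalRep (Fin N)) W Λ₄ K₄) (hM₁ : ∀ U, |X U| ≤ M₁) (hM₂ : ∀ U, |Y U| ≤ M₂)
    {n : ℕ} {L M : ℝ≥0} (hn₁ : Λ₁.card ≤ n) (hn₂ : Λ₂.card ≤ n) (hn₄ : Λ₄.card ≤ n) (hL₁ : K₁ ≤ L) (hL₂ : K₂ ≤ L)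
    (hL₄ : K₄ ≤ L) (hMM₁ : M₁ ≤ M) (hMM₂ : M₂ ≤ M)
    {m : ℕ} (hsep : ∀ a ∈ Λ₁ ∪ Λ₂, ∀ b ∈ Λ₄, (m : ℝ) ≤ ‖a.1 - b.1‖) :
    |cov[fun U => X U * Y U, W; μ]| ≤ 4 * (2 * Real.sqrt N) ^ 2 * Real.exp (-(dimκ(d, K * (b₁ / N)) * ((m - 2 : ℕ) : ℝ))) *
      (2 * (n : ℝ) * (2 * (M : ℝ) * L)) * ((n : ℝ) * L) := by
  classical
  have c := abs_cov_le_of_sep_dim hd hN hK0 hmod hR hdoor h0 hb hμ (isLipschitzCylinder_mul hX hY hM₁ hM₂) hW hsep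
  simp only [NNReal.coe_add, NNReal.coe_mul] at c
  have hn₄' : (Λ₄.card : ℝ) ≤ n := by exact_mod_cast hn₄
  have hL₁' : (K₁ : ℝ) ≤ L := by exact_mod_cast hL₁
  have hL₂' : (K₂ : ℝ) ≤ L := by exact_mod_cast hL₂
  have hL₄' : (K₄ : ℝ) ≤ L := by exact_mod_cast hL₄
  have hM₁' : (M₁ : ℝ) ≤ M := by exact_mod_cast hMM₁
  have hM₂' : (M₂ : ℝ) ≤ M := by exact_mod_cast hMM₂
  have hM0 : (0 : ℝ) ≤ M := M.2
  have hu12 : ((Λ₁ ∪ Λ₂).card : ℝ) ≤ 2 * n := by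
    have h := Finset.card_union_le Λ₁ Λ₂
    have h' : ((Λ₁ ∪ Λ₂).card : ℝ) ≤ Λ₁.card + Λ₂.card := by exact_mod_cast h
    have hn₁' : (Λ₁.card : ℝ) ≤ n := by exact_mod_cast hn₁
    have hn₂' : (Λ₂.card : ℝ) ≤ n := by exact_mod_cast hn₂
    linarith
  have hK : (M₁ : ℝ) * K₂ + M₂ * K₁ ≤ 2 * (M : ℝ) * L := by
    linarith [mul_le_mul hM₁' hL₂' K₂.2 hM0, mul_le_mul hM₂' hL₁' K₁.2 hM0]
  exact le_crude c (by positivity) (by positivity) (by positivity) (mul_le_mul hu12 hK (by positivity) (by positivity))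
    (mul_le_mul hn₄' hL₄' K₄.2 (Nat.cast_nonneg _))

/-- Crude triple–single bound: `|Cov(XYZ, W)| ≤ E(m) (3n·3M²L)(nL)`. -/
theorem cov_crude3_dim (hd : 2 ≤ d) (hN : 1 ≤ N) (hK0 : 0 ≤ K)
    (hmod : OneLinkKRModulus N R K) (hR : b₁ / N * (2 * ((d : ℝ) - 1)) ≤ R) (hdoor : doorPoly d (K * (b₁ / N)) < 1)
    (h0 : 0 ≤ b) (hb : b ≤ b₁) (hμ : μ ∈ ymGibbsMeasures (d := d) (fundamentalRep (Fin N)) b)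
    {X Y Z W : LGConfig d (Matrix.specialUnitaryGroup (Fin N) ℂ) → ℝ} {Λ₁ Λ₂ Λ₃ Λ₄ : Finset (ZdEdge d)}
    {K₁ K₂ K₃ K₄ M₁ M₂ M₃ : ℝ≥0}
    (hX : IsLipschitzCylinder (fundamentalRep (Fin N)) X Λ₁ K₁) (hY : IsLipschitzCylinder (fundamentalRep (Fin N)) Y Λ₂ K₂)
    (hZ : IsLipschitzCylinder (fundamentalRep (Fin N)) Z Λ₃ K₃) (hW : IsLipschitzCylinder (fundamentalRep (Fin N)) W Λ₄ K₄)
    (hM₁ : ∀ U, |X U| ≤ M₁) (hM₂ : ∀ U, |Y U| ≤ M₂) (hM₃ : ∀ U, |Z U| ≤ M₃)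
    {n : ℕ} {L M : ℝ≥0} (hn₁ : Λ₁.card ≤ n) (hn₂ : Λ₂.card ≤ n) (hn₃ : Λ₃.card ≤ n) (hn₄ : Λ₄.card ≤ n)
    (hL₁ : K₁ ≤ L) (hL₂ : K₂ ≤ L) (hL₃ : K₃ ≤ L) (hL₄ : K₄ ≤ L) (hMM₁ : M₁ ≤ M) (hMM₂ : M₂ ≤ M) (hMM₃ : M₃ ≤ M)
    {m : ℕ} (hsep : ∀ a ∈ Λ₁ ∪ Λ₂ ∪ Λ₃, ∀ b ∈ Λ₄, (m : ℝ) ≤ ‖a.1 - b.1‖) :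
    |cov[fun U => X U * Y U * Z U, W; μ]| ≤ 4 * (2 * Real.sqrt N) ^ 2 * Real.exp (-(dimκ(d, K * (b₁ / N)) * ((m - 2 : ℕ) : ℝ))) *
      (3 * (n : ℝ) * (3 * (M : ℝ) ^ 2 * L)) * ((n : ℝ) * L) := by
  classical
  have hXY := isLipschitzCylinder_mul hX hY hM₁ hM₂
  have hM₁₂ : ∀ U, |X U * Y U| ≤ ((M₁ * M₂ : ℝ≥0) : ℝ) := fun U => by
    push_cast; exact abs_mul_le_mul_of_abs_le hM₁ hM₂ U
  have c := abs_cov_le_of_sep_dim hd hN hK0 hmod hR hdoor h0 hb hμ (isLipschitzCylinder_mul hXY hZ hM₁₂ hM₃) hW hsep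
  simp only [NNReal.coe_add, NNReal.coe_mul] at c
  have hn₄' : (Λ₄.card : ℝ) ≤ n := by exact_mod_cast hn₄
  have hL₁' : (K₁ : ℝ) ≤ L := by exact_mod_cast hL₁
  have hL₂' : (K₂ : ℝ) ≤ L := by exact_mod_cast hL₂
  have hL₃' : (K₃ : ℝ) ≤ L := by exact_mod_cast hL₃
  have hL₄' : (K₄ : ℝ) ≤ L := by exact_mod_cast hL₄
  have hM₁' : (M₁ : ℝ) ≤ M := by exact_mod_cast hMM₁
  have hM₂' : (M₂ : ℝ) ≤ M := by exact_mod_cast hMM₂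
  have hM₃' : (M₃ : ℝ) ≤ M := by exact_mod_cast hMM₃
  have hM0 : (0 : ℝ) ≤ M := M.2
  have hu123 : ((Λ₁ ∪ Λ₂ ∪ Λ₃).card : ℝ) ≤ 3 * n := by
    have h := Finset.card_union_le (Λ₁ ∪ Λ₂) Λ₃
    have h2 := Finset.card_union_le Λ₁ Λ₂
    have h' : ((Λ₁ ∪ Λ₂ ∪ Λ₃).card : ℝ) ≤ (Λ₁ ∪ Λ₂).card + Λ₃.card := by exact_mod_cast h
    have h2' : ((Λ₁ ∪ Λ₂).card : ℝ) ≤ Λ₁.card + Λ₂.card := by exact_mod_cast h2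
    have hn₁' : (Λ₁.card : ℝ) ≤ n := by exact_mod_cast hn₁
    have hn₂' : (Λ₂.card : ℝ) ≤ n := by exact_mod_cast hn₂
    have hn₃' : (Λ₃.card : ℝ) ≤ n := by exact_mod_cast hn₃
    linarith
  have hK : (M₁ : ℝ) * M₂ * K₃ + M₃ * ((M₁ : ℝ) * K₂ + M₂ * K₁) ≤ 3 * (M : ℝ) ^ 2 * L := by
    have i1 : (M₁ : ℝ) * M₂ * K₃ ≤ M * M * L :=
      mul_le_mul (mul_le_mul hM₁' hM₂' M₂.2 hM0) hL₃' K₃.2 (by positivity)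
    have i2 : (M₁ : ℝ) * K₂ ≤ M * L := mul_le_mul hM₁' hL₂' K₂.2 hM0
    have i3 : (M₂ : ℝ) * K₁ ≤ M * L := mul_le_mul hM₂' hL₁' K₁.2 hM0
    have i4 : (M₃ : ℝ) * ((M₁ : ℝ) * K₂ + M₂ * K₁) ≤ M * (M * L + M * L) :=
      mul_le_mul hM₃' (add_le_add i2 i3) (by positivity) hM0
    nlinarith [i1, i4]
  exact le_crude c (by positivity) (by positivity) (by positivity) (mul_le_mul hu123 hK (by positivity) (by positivity))
    (mul_le_mul hn₄' hL₄' K₄.2 (Nat.cast_nonneg _))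

/-- Crude pair–pair bound: `|Cov(XY, ZW)| ≤ E(m) (2n·2ML)(2n·2ML)`. -/
theorem cov_crude4_dim (hd : 2 ≤ d) (hN : 1 ≤ N) (hK0 : 0 ≤ K)
    (hmod : OneLinkKRModulus N R K) (hR : b₁ / N * (2 * ((d : ℝ) - 1)) ≤ R) (hdoor : doorPoly d (K * (b₁ / N)) < 1)
    (h0 : 0 ≤ b) (hb : b ≤ b₁) (hμ : μ ∈ ymGibbsMeasures (d := d) (fundamentalRep (Fin N)) b)
    {X Y Z W : LGConfig d (Matrix.specialUnitaryGroup (Fin N) ℂ) → ℝ} {Λ₁ Λ₂ Λ₃ Λ₄ : Finset (ZdEdge d)}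
    {K₁ K₂ K₃ K₄ M₁ M₂ M₃ M₄ : ℝ≥0}
    (hX : IsLipschitzCylinder (fundamentalRep (Fin N)) X Λ₁ K₁) (hY : IsLipschitzCylinder (fundamentalRep (Fin N)) Y Λ₂ K₂)
    (hZ : IsLipschitzCylinder (fundamentalRep (Fin N)) Z Λ₃ K₃) (hW : IsLipschitzCylinder (fundamentalRep (Fin N)) W Λ₄ K₄)
    (hM₁ : ∀ U, |X U| ≤ M₁) (hM₂ : ∀ U, |Y U| ≤ M₂) (hM₃ : ∀ U, |Z U| ≤ M₃) (hM₄ : ∀ U, |W U| ≤ M₄)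
    {n : ℕ} {L M : ℝ≥0} (hn₁ : Λ₁.card ≤ n) (hn₂ : Λ₂.card ≤ n) (hn₃ : Λ₃.card ≤ n) (hn₄ : Λ₄.card ≤ n)
    (hL₁ : K₁ ≤ L) (hL₂ : K₂ ≤ L) (hL₃ : K₃ ≤ L) (hL₄ : K₄ ≤ L)
    (hMM₁ : M₁ ≤ M) (hMM₂ : M₂ ≤ M) (hMM₃ : M₃ ≤ M) (hMM₄ : M₄ ≤ M)
    {m : ℕ} (hsep : ∀ a ∈ Λ₁ ∪ Λ₂, ∀ b ∈ Λ₃ ∪ Λ₄, (m : ℝ) ≤ ‖a.1 - b.1‖) :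
    |cov[fun U => X U * Y U, fun U => Z U * W U; μ]| ≤
      4 * (2 * Real.sqrt N) ^ 2 * Real.exp (-(dimκ(d, K * (b₁ / N)) * ((m - 2 : ℕ) : ℝ))) *
      (2 * (n : ℝ) * (2 * (M : ℝ) * L)) * (2 * (n : ℝ) * (2 * (M : ℝ) * L)) := by
  classical
  have c := abs_cov_le_of_sep_dim hd hN hK0 hmod hR hdoor h0 hb hμ (isLipschitzCylinder_mul hX hY hM₁ hM₂) (isLipschitzCylinder_mul hZ hW hM₃ hM₄) hsep
  simp only [NNReal.coe_add, NNReal.coe_mul] at c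
  have hL₁' : (K₁ : ℝ) ≤ L := by exact_mod_cast hL₁
  have hL₂' : (K₂ : ℝ) ≤ L := by exact_mod_cast hL₂
  have hL₃' : (K₃ : ℝ) ≤ L := by exact_mod_cast hL₃
  have hL₄' : (K₄ : ℝ) ≤ L := by exact_mod_cast hL₄
  have hM₁' : (M₁ : ℝ) ≤ M := by exact_mod_cast hMM₁
  have hM₂' : (M₂ : ℝ) ≤ M := by exact_mod_cast hMM₂
  have hM₃' : (M₃ : ℝ) ≤ M := by exact_mod_cast hMM₃
  have hM₄' : (M₄ : ℝ) ≤ M := by exact_mod_cast hMM₄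
  have hM0 : (0 : ℝ) ≤ M := M.2
  have hu12 : ((Λ₁ ∪ Λ₂).card : ℝ) ≤ 2 * n := by
    have h := Finset.card_union_le Λ₁ Λ₂
    have h' : ((Λ₁ ∪ Λ₂).card : ℝ) ≤ Λ₁.card + Λ₂.card := by exact_mod_cast h
    have hn₁' : (Λ₁.card : ℝ) ≤ n := by exact_mod_cast hn₁
    have hn₂' : (Λ₂.card : ℝ) ≤ n := by exact_mod_cast hn₂
    linarith
  have hu34 : ((Λ₃ ∪ Λ₄).card : ℝ) ≤ 2 * n := by
    have h := Finset.card_union_le Λ₃ Λ₄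
    have h' : ((Λ₃ ∪ Λ₄).card : ℝ) ≤ Λ₃.card + Λ₄.card := by exact_mod_cast h
    have hn₃' : (Λ₃.card : ℝ) ≤ n := by exact_mod_cast hn₃
    have hn₄' : (Λ₄.card : ℝ) ≤ n := by exact_mod_cast hn₄
    linarith
  have hK12 : (M₁ : ℝ) * K₂ + M₂ * K₁ ≤ 2 * (M : ℝ) * L := by
    linarith [mul_le_mul hM₁' hL₂' K₂.2 hM0, mul_le_mul hM₂' hL₁' K₁.2 hM0]
  have hK34 : (M₃ : ℝ) * K₄ + M₄ * K₃ ≤ 2 * (M : ℝ) * L := by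
    linarith [mul_le_mul hM₃' hL₄' K₄.2 hM0, mul_le_mul hM₄' hL₃' K₃.2 hM0]
  exact le_crude c (by positivity) (by positivity) (by positivity) (mul_le_mul hu12 hK12 (by positivity) (by positivity))
    (mul_le_mul hu34 hK34 (by positivity) (by positivity))

/-- Crude single–pair bound: `|Cov(Y, ZW)| ≤ E(m) (nL)(2n·2ML)`. -/
theorem cov_crude2'_dim (hd : 2 ≤ d) (hN : 1 ≤ N) (hK0 : 0 ≤ K)
    (hmod : OneLinkKRModulus N R K) (hR : b₁ / N * (2 * ((d : ℝ) - 1)) ≤ R) (hdoor : doorPoly d (K * (b₁ / N)) < 1)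
    (h0 : 0 ≤ b) (hb : b ≤ b₁) (hμ : μ ∈ ymGibbsMeasures (d := d) (fundamentalRep (Fin N)) b)
    {Y Z W : LGConfig d (Matrix.specialUnitaryGroup (Fin N) ℂ) → ℝ} {Λ₂ Λ₃ Λ₄ : Finset (ZdEdge d)} {K₂ K₃ K₄ M₃ M₄ : ℝ≥0}
    (hY : IsLipschitzCylinder (fundamentalRep (Fin N)) Y Λ₂ K₂) (hZ : IsLipschitzCylinder (fundamentalRep (Fin N)) Z Λ₃ K₃)
    (hW : IsLipschitzCylinder (fundamentalRep (Fin N)) W Λ₄ K₄) (hM₃ : ∀ U, |Z U| ≤ M₃) (hM₄ : ∀ U, |W U| ≤ M₄)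
    {n : ℕ} {L M : ℝ≥0} (hn₂ : Λ₂.card ≤ n) (hn₃ : Λ₃.card ≤ n) (hn₄ : Λ₄.card ≤ n) (hL₂ : K₂ ≤ L) (hL₃ : K₃ ≤ L)
    (hL₄ : K₄ ≤ L) (hMM₃ : M₃ ≤ M) (hMM₄ : M₄ ≤ M)
    {m : ℕ} (hsep : ∀ a ∈ Λ₂, ∀ b ∈ Λ₃ ∪ Λ₄, (m : ℝ) ≤ ‖a.1 - b.1‖) :
    |cov[Y, fun U => Z U * W U; μ]| ≤ 4 * (2 * Real.sqrt N) ^ 2 * Real.exp (-(dimκ(d, K * (b₁ / N)) * ((m - 2 : ℕ) : ℝ))) *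
      ((n : ℝ) * L) * (2 * (n : ℝ) * (2 * (M : ℝ) * L)) := by
  classical
  have c := abs_cov_le_of_sep_dim hd hN hK0 hmod hR hdoor h0 hb hμ hY (isLipschitzCylinder_mul hZ hW hM₃ hM₄) hsep
  simp only [NNReal.coe_add, NNReal.coe_mul] at c
  have hn₂' : (Λ₂.card : ℝ) ≤ n := by exact_mod_cast hn₂
  have hL₂' : (K₂ : ℝ) ≤ L := by exact_mod_cast hL₂
  have hL₃' : (K₃ : ℝ) ≤ L := by exact_mod_cast hL₃
  have hL₄' : (K₄ : ℝ) ≤ L := by exact_mod_cast hL₄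
  have hM₃' : (M₃ : ℝ) ≤ M := by exact_mod_cast hMM₃
  have hM₄' : (M₄ : ℝ) ≤ M := by exact_mod_cast hMM₄
  have hM0 : (0 : ℝ) ≤ M := M.2
  have hu34 : ((Λ₃ ∪ Λ₄).card : ℝ) ≤ 2 * n := by
    have h := Finset.card_union_le Λ₃ Λ₄
    have h' : ((Λ₃ ∪ Λ₄).card : ℝ) ≤ Λ₃.card + Λ₄.card := by exact_mod_cast h
    have hn₃' : (Λ₃.card : ℝ) ≤ n := by exact_mod_cast hn₃
    have hn₄' : (Λ₄.card : ℝ) ≤ n := by exact_mod_cast hn₄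
    linarith
  have hK : (M₃ : ℝ) * K₄ + M₄ * K₃ ≤ 2 * (M : ℝ) * L := by
    linarith [mul_le_mul hM₃' hL₄' K₄.2 hM0, mul_le_mul hM₄' hL₃' K₃.2 hM0]
  exact le_crude c (by positivity) (by positivity) (by positivity) (mul_le_mul hn₂' hL₂' K₂.2 (Nat.cast_nonneg _))
    (mul_le_mul hu34 hK (by positivity) (by positivity))

end Crude

end Summit.Ventures.YMGap.CouplingResponse

end
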